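import Summits.QuantumAdvantage.QuantumAdvantage.Theorems.ArithStatLadderEndJuntaRungProgressions
import Summits.QuantumAdvantage.QuantumAdvantage.Theorems.ArithStatLadderEndJuntaRungCylinders
import Literature.NumberTheory.QuadraticFields.ThreeTorsionMeanTwoAdic

/-!
# `EndJuntaRung` (stmt-QuantumAdvantage-2426) from Taniguchi–Thorne at the prime `2`

Route `ArithStatLadder`, support item `EndJuntaRung` (R0, "IN PRINT modulo bookkeeping"): the centred
3-torsion `t(−d) − 2` of the class groups of imaginary quadratic fields has vanishing correlation with
every junta on `k` low + `k` high binary digits of `d`, along `n`-bit fundamental `−d`.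

* `EndJuntaRung_of_tt_threeTorsion_twoAdic` — `tt_threeTorsion_twoAdic → EndJuntaRung`.

The hypothesis is the named fact `Literature.NumberTheory.QuadraticFields.tt_threeTorsion_twoAdic`
(Taniguchi–Thorne 2013, Duke Math. J. 162: Thm 4 with a local specification at `2`, and Thm 25 for
Dirichlet characters of `2`-power modulus with `χ⁶ ≠ 1` — Shintani zeta functions, not in the tree), so
the result is CONDITIONAL on it and on nothing else: the bookkeeping is proved in
`ArithStatLadderEndJuntaRungCharacters` (Hensel at `2`, characters `mod 2ʲ`, orthogonality),
`ArithStatLadderEndJuntaRungCounts` (Lemma 21 in the `2`-adic types, character sums),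
`ArithStatLadderEndJuntaRungProgressions` (mean `2` in every class `mod 2ᵏ`) and
`ArithStatLadderEndJuntaRungCylinders` (low bits = class `mod 2ᵏ`, high bits = dyadic sub-interval,
density of the block).
-/

noncomputable section

set_option linter.dupNamespace false -- D-0017: single-problem summit ⇒ `QuantumAdvantage.QuantumAdvantage` by design

namespace Summit.QuantumAdvantage.QuantumAdvantage.Theorems.ArithStatLadder

open Literature.NumberTheory.QuadraticFields

/-- **`EndJuntaRung` from Taniguchi–Thorne at the prime `2`.** Under the named fact
`tt_threeTorsion_twoAdic` (Taniguchi–Thorne 2013, Thm 4 with a local specification at `2` and Thm 25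
for characters `mod 2ᵏ` with `χ⁶ ≠ 1`), the first rung of route `ArithStatLadder` holds: for every
statistic `t` pinned to `#Cl(K)[3]`, every `k` and `ε > 0`, eventually in `n`, every cylinder on `k`
low and `k` high bits of the `n`-bit `d` with `−d` fundamental has centred sum
`|Σ (t(−d) − 2)| ≤ ε #𝒟_n` (`progression_eventually` + `endJuntaRung_of_progressions`). -/
theorem EndJuntaRung_of_tt_threeTorsion_twoAdic (hF : tt_threeTorsion_twoAdic) :
    Summit.QuantumAdvantage.QuantumAdvantage.Theses.ArithStatLadder.EndJuntaRung :=
  endJuntaRung_of_progressions fun k a _ hε =>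
    progression_eventually (fun r hr s hs he => (hF r hr s hs he).1.1)
      (fun r hr s hs he k' χ hχ => ((hF r hr s hs he).2 k' χ hχ).1) k a hε

end Summit.QuantumAdvantage.QuantumAdvantage.Theorems.ArithStatLadder

end
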